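import Mathlib
import Summits.Ventures.PercRepro2.CoinFourAtomPush
import Summits.Ventures.PercRepro2.CoinChainAWorldLemmas
import Summits.Ventures.PercRepro2.CoinChainDecreasing

/-!
# The pure AND-switch chain with no pivotality on the marker-free clusters — the four-atom
sandwich (blind cell PercRepro2, night-2 g19; proofs/NIGHT2-DARC.md §59.14)

The covering-marker theorem of §57 (`fourAtom_functional_nonneg'`) needs the gate to equal
the `R`-law on every cluster missing BOTH markers.  For the pure chain that is the case exactly
when no marker-free cluster is pivotal: `d' W = d W` for every `W` meeting `ent'` with
`m₁, m₂ ∉ W` (`h00`) — e.g. when the entries not covered by the markers are head-blind and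
`w` reaches the target only when `a` does.  Both laws are log-supermodular (`mixture_lsm`),
the gate is below the `R`-law, so the functional is nonnegative for every `ρ`:
`pureChain_functional_nonneg_of_noPivot00`.  A FOURTH sufficient condition of the row; it
covers the «hard core» instances of §59.13 (there `d'(∅) = d(∅)` and the uncovered entry is
head-blind).
-/

namespace Summit.Ventures.PercRepro2.Coin

section ChainNoPivot00

variable {V : Type*} [DecidableEq V] {R : Type*} [Field R] [LinearOrder R] [IsStrictOrderedRing R]

/-- **THE PURE CHAIN WITH NO PIVOTALITY ON THE MARKER-FREE CLUSTERS.**  With the hypotheses of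
`mixture_lsm` for `(c, d)` and `(c, d')`, `d' ≤ d`, and `d' W = d W` on every entered cluster
`W` missing both markers (`h00`), the cleared functional is `≥ 0` — by the four-atom sandwich
`fourAtom_functional_nonneg'`. -/
theorem pureChain_functional_nonneg_of_noPivot00 (U ent' : Finset V) (ν c d d' : Finset V → R)
    (ρ : R) (hρ0 : 0 ≤ ρ) (hρ1 : ρ ≤ 1) (hν0 : ∀ W, 0 ≤ ν W)
    (hν : ∀ s ⊆ U, ∀ t ⊆ U, ν s * ν t ≤ ν (s ∩ t) * ν (s ∪ t))
    (hc0 : ∀ W, 0 ≤ c W) (hd0 : ∀ W, 0 ≤ d W) (hd'0 : ∀ W, 0 ≤ d' W)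
    (hdc : ∀ W, d W ≤ c W) (hd'c : ∀ W, d' W ≤ c W) (hd'd : ∀ W, d' W ≤ d W)
    (hcc : ∀ s t, c s * c t ≤ c (s ∩ t) * c (s ∪ t))
    (hdd : ∀ s t, d s * d t ≤ d (s ∩ t) * d (s ∪ t))
    (hd'd' : ∀ s t, d' s * d' t ≤ d' (s ∩ t) * d' (s ∪ t))
    (hcd : ∀ s t, c s * d t ≤ c (s ∩ t) * d (s ∪ t))
    (hcd' : ∀ s t, c s * d' t ≤ c (s ∩ t) * d' (s ∪ t))
    (hratio : ∀ s t, s ⊆ t → d s * c t ≤ c s * d t)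
    (hratio' : ∀ s t, s ⊆ t → d' s * c t ≤ c s * d' t) (m₁ m₂ : V)
    (h00 : ∀ W ⊆ U, m₁ ∉ W → m₂ ∉ W → (∃ r ∈ ent', r ∈ W) → d' W = d W) :
    0 ≤ (∑ W ∈ U.powerset, ν W * chainMix ∅ ent' ρ c d W) ^ 2 *
          (∑ W ∈ U.powerset, ν W * chainMix ∅ ent' ρ c d' W *
            ((if m₁ ∈ W then (1 : R) else 0) * (if m₂ ∈ W then (1 : R) else 0)))
        - (∑ W ∈ U.powerset, ν W * chainMix ∅ ent' ρ c d W) *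
          (∑ W ∈ U.powerset, ν W * chainMix ∅ ent' ρ c d W * (if m₁ ∈ W then (1 : R) else 0)) *
          (∑ W ∈ U.powerset, ν W * chainMix ∅ ent' ρ c d' W * (if m₂ ∈ W then (1 : R) else 0))
        - (∑ W ∈ U.powerset, ν W * chainMix ∅ ent' ρ c d W) *
          (∑ W ∈ U.powerset, ν W * chainMix ∅ ent' ρ c d W * (if m₂ ∈ W then (1 : R) else 0)) *
          (∑ W ∈ U.powerset, ν W * chainMix ∅ ent' ρ c d' W * (if m₁ ∈ W then (1 : R) else 0))
        + (∑ W ∈ U.powerset, ν W * chainMix ∅ ent' ρ c d W * (if m₁ ∈ W then (1 : R) else 0)) *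
          (∑ W ∈ U.powerset, ν W * chainMix ∅ ent' ρ c d W * (if m₂ ∈ W then (1 : R) else 0)) *
          (∑ W ∈ U.powerset, ν W * chainMix ∅ ent' ρ c d' W) := by
  have hm0 : ∀ W, 0 ≤ chainMix ∅ ent' ρ c d W := chainMix_nonneg ∅ ent' hρ0 hρ1 hc0 hd0
  have hm'0 : ∀ W, 0 ≤ chainMix ∅ ent' ρ c d' W := chainMix_nonneg ∅ ent' hρ0 hρ1 hc0 hd'0
  have hmix := mixture_lsm ∅ ent' ρ hρ0 hρ1 c d hc0 hd0 hdc hcc hdd hcd hratio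
  have hmix' := mixture_lsm ∅ ent' ρ hρ0 hρ1 c d' hc0 hd'0 hd'c hcc hd'd' hcd' hratio'
  refine fourAtom_functional_nonneg' U (fun W => ν W * chainMix ∅ ent' ρ c d W)
    (fun W => ν W * chainMix ∅ ent' ρ c d' W) m₁ m₂
    (fun W => mul_nonneg (hν0 W) (hm0 W)) (fun W => mul_nonneg (hν0 W) (hm'0 W)) ?_ ?_ ?_ ?_
  · intro s hs t ht
    calc ν s * chainMix ∅ ent' ρ c d s * (ν t * chainMix ∅ ent' ρ c d t)
        = (ν s * ν t) * (chainMix ∅ ent' ρ c d s * chainMix ∅ ent' ρ c d t) := by ring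
      _ ≤ (ν (s ∩ t) * ν (s ∪ t)) *
            (chainMix ∅ ent' ρ c d (s ∩ t) * chainMix ∅ ent' ρ c d (s ∪ t)) :=
          mul_le_mul (hν s hs t ht) (hmix s t) (mul_nonneg (hm0 _) (hm0 _))
            (mul_nonneg (hν0 _) (hν0 _))
      _ = _ := by ring
  · intro s hs t ht
    calc ν s * chainMix ∅ ent' ρ c d' s * (ν t * chainMix ∅ ent' ρ c d' t)
        = (ν s * ν t) * (chainMix ∅ ent' ρ c d' s * chainMix ∅ ent' ρ c d' t) := by ring
      _ ≤ (ν (s ∩ t) * ν (s ∪ t)) *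
            (chainMix ∅ ent' ρ c d' (s ∩ t) * chainMix ∅ ent' ρ c d' (s ∪ t)) :=
          mul_le_mul (hν s hs t ht) (hmix' s t) (mul_nonneg (hm'0 _) (hm'0 _))
            (mul_nonneg (hν0 _) (hν0 _))
      _ = _ := by ring
  · intro W _
    refine mul_le_mul_of_nonneg_left ?_ (hν0 W)
    unfold chainMix
    have := chainTheta_nonneg ∅ ent' hρ0 W
    nlinarith [hd'd W]
  · intro W hW h1 h2
    have hWU : W ⊆ U := Finset.mem_powerset.1 hW
    unfold chainMix
    rw [chainTheta_empty]
    by_cases hent : ∃ r ∈ ent', r ∈ W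
    · rw [if_pos hent, h00 W hWU h1 h2 hent]
    · rw [if_neg hent]; ring

end ChainNoPivot00

end Summit.Ventures.PercRepro2.Coin
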